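import Literature.NumberTheory.EllipticCurves.Kim2025.StructureClauseOPEN
import Summits.BirchSwinnertonDyer.Rank1Residual.Additive.X4SharpThreeKimLattice
import Summits.BirchSwinnertonDyer.Rank1Residual.Additive.X4SharpThreeKimRefinedConsequences
import Summits.BirchSwinnertonDyer.Rank1Residual.Additive.PlusSymbolIntegrality
import HarnessLib

/-!
# N11 — Kim-at-3, analytic rank 0, `E(ℚ₃)[3] = 0`: the CELL THEOREM of `bsd-addord` seat kim3 as a
# NAME, with its sanity edge and its consumer edges (planner ruling R-KIM3, TARGET.md v2 §8)

HONEST FRAMING. Cell `bsd-addord` (run/shared/lean/pub/bsd-addord/) writes PROOFS FROM PUBLISHED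
inputs for the combination-shaped residual classes of the rank-`≤ 1` BSD formula and has them
refereed inside the cell; a PASSed memo is a CELL THEOREM, not a Literature fact and not a kernel
proof. This file NAMES the statement proved by the memo `kim3/KIM3-PROOF.md` (Theorem A: C.-H. Kim,
arXiv:2505.09121 Thm. 1.1 (BSD clause) + Thm. 1.2 (rk 0) at `p = 3` for elliptic curves with the
`3`-adic tower onto and `E(ℚ₃)[3] = 0`, from [Kato 2004, Thm. 12.5/9.7/6.6, Ex. 13.3, §8.3];
[Mazur–Rubin 2004, Ch. 4–5 + App. A/B, (H.4)-free items, every Prop. 3.6.1 call audited at `p = 3`];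
[Sakamoto, JTNB 36 (2024), Thm. 4.4 / Cor. 5.5 / Thm. 6.7]; [Bloch–Kato 1990]; [Kim, AJM 148 (2026) §3]
as a `p`-generic computation with the memo's `p = 3` lemmas L (local lattice `3^{v₃(c₃)−t}`), L′
(semi-local lattice over unramified `3`-power extensions) and Prop. D (the Kato ↔ Kurihara dictionary
by a moment calculus)). NOTHING is asserted by the `def`; every theorem below takes the name as an
EXPLICIT hypothesis `(hK : KimAtThreeRankZeroPUB)`. The ANNOUNCED record
`Literature.NumberTheory.EllipticCurves.Kim2025.thm11_kimShaLength_of_integralPeriod_OPEN` and its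
`Kim2025-preprint` flag are UNTOUCHED; `kimAtThreeRankZeroPUB_of_thm11_OPEN` is the sanity edge
(the announced record implies the name).

WHAT THE NAME DOES NOT SAY (strictly weaker than `KimThreeShaLength` / `X4SharpThreeKimShaLength` of
`Additive/X4SharpThreeKimShaLength.lean`, which have no `t`-binder): the `{t > 0}` stratum
(`E(ℚ₃)[3] ≠ 0 ⟺ a₂ ≡ 6 (mod 9)` on a `3`-divisible minimal model), the EXOTIC rows (surj(3) without
the tower; Elkies) and the non-surjective rows (O8) are outside; the class statements are NOT
discharged; on `3 ∣ ∏ c_ℓ` rows only level-`k` certificates or the Tamagawa-defect equality have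
content (`bsdp_three_iff_partialInfty_eq_of_kimAtThreeRankZeroPUB`).

## Contents

* `KimAtThreeRankZeroPUB` — the name (body VERBATIM from the cell file `kim3/KIM3-Statement.lean`).
* `kimAtThreeRankZeroPUB_of_thm11_OPEN` — sanity edge from the announced record.
* `kimShaLengthAt_three_of_kimAtThreeRankZeroPUB`, `kimShaLengthRankZeroAt_three_of_kimAtThreeRankZeroPUB`,
  `kimRankZeroShaLengthAt_three_of_kimAtThreeRankZeroPUB`, `kimRankZeroLowerBoundAt_three_of_…` — the
  name implies the tree's per-pair `∂`-exact core (`X4.KimShaLengthAt`, `X4.KimShaLengthRankZeroAt`) and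
  the `{tower ∧ t = 0}`-restricted predicates `KimRankZeroShaLengthAt W 3`, `KimRankZeroLowerBoundAt W 3`.
* Per-pair consumer edges (Cor. C of the memo): `bsdp_three_iff_partialInfty_eq_of_kimAtThreeRankZeroPUB`
  (what `BSD(E,3)` IS on such a row), `bsdp_three_iff_not_dvd_tam_of_kimAtThreeRankZeroPUB_of_kuriharaUnitAt`,
  `bsdp_three_of_kimAtThreeRankZeroPUB_of_kuriharaUnitAt` (LOWER@3 + BSD(E,3) by ONE unit Kurihara
  number on `3 ∤ ∏ c_ℓ` rows, no `#Ш_an` hypothesis), `missingLowerBoundAt_three_of_kimAtThreeRankZeroPUB_of_indexCert`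
  (level-`k` certificates, `k − 1 ≤ ord₃ ∏ c_ℓ`), `sha_le_three_of_kimAtThreeRankZeroPUB` (the X4♯(3)
  inequality), `not_kuriharaUnitAt_three_of_kimAtThreeRankZeroPUB_of_bsdp_of_dvd` (the falsifiable
  prediction on Tamagawa-obstructed rows).

References: [Kim2025RefinedTNC] Thm. 1.1, Thm. 1.2, Cor. 1.7; [Sakamoto2024] Thm. 4.4, Cor. 5.5, Thm. 6.7;
[MazurRubin2004]; [Kato2004Asterisque]; [Kim2022StructureSelmer] §3, Thm. 1.9 (6); [Miller2011LMS]
Def. 1.1; memo `run/shared/lean/pub/bsd-addord/kim3/KIM3-PROOF.md`; planner ruling R-KIM3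
(`run/shared/lean/pub/bsd-addord/TARGET.md` v2 §8).
-/

noncomputable section

open scoped MatrixGroups ModularForm Classical

open CongruenceSubgroup WeierstrassCurve Literature.NumberTheory.EllipticCurves
  Literature.NumberTheory.EllipticCurves.ModularForms
  Literature.NumberTheory.EllipticCurves.Kim2025
  Literature.NumberTheory.EllipticCurves.Rank1Residual
  Literature.NumberTheory.EllipticCurves.Rank1Residual.Typed

namespace Summit.BirchSwinnertonDyer.Rank1Residual.Additive.N11

open Summit.BirchSwinnertonDyer.Rank1Residual.X4

/-- **Kim-at-3, rank 0, `E(ℚ₃)[3] = 0` — CELL THEOREM of `bsd-addord` seat kim3** (memo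
`kim3/KIM3-PROOF.md`, Theorem A; TEXT OF RECORD v1.4, sha256 `2fc4b0b8d0fb9a83858198bbda5193ee7cffb169c6b36f35bf8d195a10ed3835`;
REFEREE VERDICT `REF kim3: PASS` with condition C10-R, cell bus `run/shared/lean/pub/bsd-addord/STATUS.md`
2026-08-25T10:14Z, report `run/shared/lean/pub/bsd-addord/REF-kim3.md`: §§3–5/§4/§7 PASS under the
binders (T), (t0), (Ω), (A); STEP-0 independently reproduced, kit j237353/j237417), proved from PUBLISHED
inputs [Ka04; MR04 (H.4)-free; S24 4.4/5.5/6.7; BK90; K26 §3 `p`-generic] + memo lemmas L / L′ / D; NOT a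
Literature fact; the announced record `Kim2025.thm11_kimShaLength_of_integralPeriod_OPEN` and its
`Kim2025-preprint` flag are untouched. CONDITION C10-R (binding, REF-kim3.md): the identification of
Kato's period with the Néron period behind the ALL-LEVELS form of `∂^{(∞)}` used here (memo §4.4(a′)
CLAIMS 1–2: `e(Ω) ≥ 0` for every `3`-integral period) is a READING of [Ka04] §4.7/§6.3/§8.3/Thm. 13.6,
not a displayed theorem there; FALLBACK = [K26] §2.3.1's normalisation under (P): an OPTIMAL
parametrisation datum `D` with `3 ∤ c_D`, on whose rows `e(Ω⁺_{D.f}) = v₃(c₃) ≥ 0` and the statement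
survives unchanged — every consumer below therefore DISPLAYS the period-transfer binder
`hper : ∃ u, ‖u‖₃ = 1 ∧ Ω(W) = u·Ω⁺_{D.f}`, which `X4.periodTransfer_of_optimal` discharges exactly under (P). For `W/ℚ` globally minimal with newform `f`, the
`3`-adic tower `ρ̄_{E,3^n}` onto for all `n`, `#E(ℚ₃)[3] = 1`, `Ш(E/ℚ)` finite, `Ω⁺_f` an integral
period of the plus symbols, and `ord(δ̃) = 0` (i.e. `δ̃_1 = L(E,1)/Ω⁺_f ≠ 0`): `∂^{(∞)}(δ̃)` is a
natural number `d` and `∂^{(0)}(δ̃) = ord₃ #Ш(E/ℚ)(3) + d`. STRICTLY WEAKER than `KimThreeShaLength`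
(the `t`-binder). A `Prop`; nothing is asserted by the `def`.
[cite: Kim2025RefinedTNC, Thm. 1.1 ("BSD") and Cor. 1.7 (PDF pp. 5–6)]
KERNEL STATUS: an OPEN obligation node (`@[conjecture]`: provable / refutable by name; the memo is a
refereed paper proof, not a kernel proof). [cite: Sakamoto2024, Thm. 4.4 (p. 926)] -/
@[conjecture] def KimAtThreeRankZeroPUB : Prop :=
  ∀ (W : WeierstrassCurve ℚ) [W.IsElliptic] [W.IsGloballyMinimal],
    (∀ n : ℕ, W.HasSurjectiveModNGaloisRep (3 ^ n : ℕ)) →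
    Nat.card {Q : (W.baseChange ℚ_[3]).toAffine.Point // (3 : ℕ) • Q = 0} = 1 →
    Finite W.sha →
    ∀ {N : ℕ} [NeZero N] (f : CuspForm (Gamma0 N) 2), IsNewformOf W f →
    (∀ r : ℚ, ratPlusSymbol f r ≠ 0 → 0 ≤ padicValRat 3 (ratPlusSymbol f r)) →
    kuriharaVanishingOrder W 3 f = 0 →
      ∃ d : ℕ, kuriharaPartialInfty W 3 f = d ∧
        kuriharaPartial W 3 f 0 =
          ((padicValNat 3 (Nat.card (AddCommGroup.primaryComponent W.sha 3)) + d : ℕ) : ℕ∞)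

/-- **Sanity edge**: the ANNOUNCED record (Kim 2025 Thm. 1.1, every `p ≥ 3`, every analytic rank)
implies the rank-`0`, `p = 3`, `E(ℚ₃)[3] = 0` name — a specialisation with one extra (unused) binder.
[cite: Kim2025RefinedTNC, Thm. 1.1 ("BSD") (PDF p. 5)] -/
theorem kimAtThreeRankZeroPUB_of_thm11_OPEN (h : thm11_kimShaLength_of_integralPeriod_OPEN) :
    KimAtThreeRankZeroPUB := by
  intro W _ _ htower _ hfin N _ f hf hint hord
  exact h W 3 le_rfl htower hfin f hf hint 0 hord

section Consumers

variable (W : WeierstrassCurve ℚ) [W.IsElliptic] [W.IsGloballyMinimal]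

omit [W.IsGloballyMinimal] in
/-- Under the tower (use `n = 1`), `E[3]` is irreducible. [folklore] -/
private theorem irreducible_three_of_tower
    (htower : ∀ n : ℕ, W.HasSurjectiveModNGaloisRep (3 ^ n : ℕ)) :
    W.HasIrreducibleModPGaloisRep 3 :=
  hasIrreducibleModPGaloisRep_of_hasSurjectiveModNGaloisRep W 3 (by simpa using htower 1)

/-- **The name gives the tree's VERBATIM CORE `X4.KimShaLengthAt W 3 f`** on a `{tower ∧ t = 0}` row
with `L(E,1) ≠ 0` and `Ш` finite, for the newform `f` of `W`: the integrality binder is the tree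
theorem `forall_padicValRat_ratPlusSymbol_nonneg_of_towerSurj`, and `L(E,1) ≠ 0` forces
`ord(δ̃) = 0` (`kuriharaVanishingOrder_eq_zero_of_ratPlusSymbol_ne_zero`), the only `r` the core asks
about. [cite: Kim2025RefinedTNC, Thm. 1.1 and Cor. 1.7] [cite: Kim2022StructureSelmer, §1.5.1 (PDF p. 7)] -/
theorem kimShaLengthAt_three_of_kimAtThreeRankZeroPUB (hK : KimAtThreeRankZeroPUB)
    (htower : ∀ n : ℕ, W.HasSurjectiveModNGaloisRep (3 ^ n : ℕ))
    (ht0 : Nat.card {Q : (W.baseChange ℚ_[3]).toAffine.Point // (3 : ℕ) • Q = 0} = 1)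
    (hfin : Finite W.sha) (hL : W.entireLFunction 1 ≠ 0)
    {N : ℕ} [NeZero N] (f : CuspForm (Gamma0 N) 2) (hf : IsNewformOf W f) :
    KimShaLengthAt W 3 f := by
  have h32 : (3 : ℕ) ≠ 2 := by norm_num
  have hirr := irreducible_three_of_tower W htower
  have hint := forall_padicValRat_ratPlusSymbol_nonneg_of_towerSurj h32 hf htower
  have hint0 : ¬ 3 ∣ (ratPlusSymbol f 0).den :=
    not_dvd_den_of_norm_ratCast_le_one (norm_ratPlusSymbol_le_one_of_irreducible h32 hf hirr 0)
  have hne : ratPlusSymbol f 0 ≠ 0 := by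
    intro h0
    apply hL
    rw [hf.entireLFunction_one_eq, h0]
    simp
  have hord : kuriharaVanishingOrder W 3 f = 0 :=
    kuriharaVanishingOrder_eq_zero_of_ratPlusSymbol_ne_zero W 3 f hint0 hne
  intro r hr
  rw [hord] at hr
  have hr0 : r = 0 := by exact_mod_cast hr.symm
  subst hr0
  exact hK W htower ht0 hfin f hf hint hord

/-- **The name gives the rank-`0` BSD-currency core `X4.KimShaLengthRankZeroAt W 3 D.f`** for a datum
`D` with the period transfer `Ω(W) = u·Ω⁺_{D.f}`, `|u|₃ = 1` (the tree's bridge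
`kimShaLengthRankZeroAt_of_kimShaLengthAt`): there are `q ∈ ℚ`, `d ∈ ℕ` with `L(E,1)/Ω(W) = q`,
`∂^{(∞)}(δ̃) = d`, `ord₃ q = ord₃ #Ш(E/ℚ)(3) + d`. No Manin-constant hypothesis.
[cite: Kim2025RefinedTNC, Thm. 1.2 (rk 0) (PDF p. 5)] [cite: Kim2022StructureSelmer, §1.4.3 and §1.5.1] -/
theorem kimShaLengthRankZeroAt_three_of_kimAtThreeRankZeroPUB (hK : KimAtThreeRankZeroPUB)
    (htower : ∀ n : ℕ, W.HasSurjectiveModNGaloisRep (3 ^ n : ℕ))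
    (ht0 : Nat.card {Q : (W.baseChange ℚ_[3]).toAffine.Point // (3 : ℕ) • Q = 0} = 1)
    (hfin : Finite W.sha) (hL : W.entireLFunction 1 ≠ 0)
    {N : ℕ} [NeZero N] (D : ModularParametrizationData W N)
    (hper : ∃ u : ℚ, ‖(u : ℚ_[3])‖ = 1 ∧ W.realPeriodRat = u * plusPeriod D.f) :
    KimShaLengthRankZeroAt W 3 D.f :=
  kimShaLengthRankZeroAt_of_kimShaLengthAt W 3 (by norm_num) (irreducible_three_of_tower W htower) hL
    D hper (kimShaLengthAt_three_of_kimAtThreeRankZeroPUB W hK htower ht0 hfin hL D.f D.isNewformOf)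

/-- **The name implies the `{tower ∧ t = 0}`-restricted N11 hypothesis `KimRankZeroShaLengthAt W 3`**
(`Additive/X4SharpThreeKimShaLength.lean`; its surj(3) and Manin binders are not needed).
[cite: Kim2025RefinedTNC, Thm. 1.1/1.2] [cite: Kim2022StructureSelmer, Thm. 1.9 (6) (PDF p. 8)] -/
theorem kimRankZeroShaLengthAt_three_of_kimAtThreeRankZeroPUB (hK : KimAtThreeRankZeroPUB)
    (ht0 : Nat.card {Q : (W.baseChange ℚ_[3]).toAffine.Point // (3 : ℕ) • Q = 0} = 1) :
    KimRankZeroShaLengthAt W 3 :=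
  fun _ htower hL hfin _ _ D _ hper =>
    kimShaLengthRankZeroAt_three_of_kimAtThreeRankZeroPUB W hK htower ht0 hfin hL D hper

/-- The name implies the unit shape `KimRankZeroUnitBoundAt W 3` and clause (6)-LOWER
`KimRankZeroLowerBoundAt W 3` on `{tower ∧ t = 0}` rows (tree bridges). Bookkeeping.
[cite: Kim2022StructureSelmer, Thm. 1.9 (1) and (6) (PDF pp. 7–8)] -/
theorem kimRankZeroLowerBoundAt_three_of_kimAtThreeRankZeroPUB (hK : KimAtThreeRankZeroPUB)
    (ht0 : Nat.card {Q : (W.baseChange ℚ_[3]).toAffine.Point // (3 : ℕ) • Q = 0} = 1) :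
    KimRankZeroUnitBoundAt W 3 ∧ KimRankZeroLowerBoundAt W 3 :=
  ⟨kimRankZeroUnitBoundAt_of_kimRankZeroShaLengthAt W 3
      (kimRankZeroShaLengthAt_three_of_kimAtThreeRankZeroPUB W hK ht0),
    kimRankZeroLowerBoundAt_of_kimRankZeroShaLengthAt W 3
      (kimRankZeroShaLengthAt_three_of_kimAtThreeRankZeroPUB W hK ht0)⟩

/-- **GRANTED the name, `BSD(E,3)` on a `{tower ∧ t = 0}` analytic-rank-`0` row IS
`∂^{(∞)}(δ̃) = ord₃ ∏_ℓ c_ℓ(E)`** (FULL Tamagawa product, the prime `3` included; GZK `hGZK` for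
`rank = r_an` and the finiteness of `Ш`; any reduction type at `3`). Memo Cor. C (TAM-DEFECT rows).
[cite: Kim2025RefinedTNC, Thm. 1.2 (rk 0)] [cite: Kim2022StructureSelmer, Conj. 1.10 (PDF p. 8)]
[cite: Miller2011LMS, Def. 1.1] -/
theorem bsdp_three_iff_partialInfty_eq_of_kimAtThreeRankZeroPUB (hK : KimAtThreeRankZeroPUB)
    (hGZK : rank_eq_analyticRank_of_analyticRank_le_one)
    (htower : ∀ n : ℕ, W.HasSurjectiveModNGaloisRep (3 ^ n : ℕ))
    (ht0 : Nat.card {Q : (W.baseChange ℚ_[3]).toAffine.Point // (3 : ℕ) • Q = 0} = 1)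
    (hL : W.entireLFunction 1 ≠ 0)
    {N : ℕ} [NeZero N] (D : ModularParametrizationData W N)
    (hper : ∃ u : ℚ, ‖(u : ℚ_[3])‖ = 1 ∧ W.realPeriodRat = u * plusPeriod D.f) :
    BSDp W 3 ↔ kuriharaPartialInfty W 3 D.f = (padicValNat 3 W.tamagawaProduct : ℕ∞) := by
  obtain ⟨hmw, hfin⟩ := hGZK W
    (by rw [analyticRank_eq_zero_of_entireLFunction_one_ne_zero hL]; exact zero_le_one)
  obtain ⟨q, d, hq, hd, hval⟩ :=
    kimShaLengthRankZeroAt_three_of_kimAtThreeRankZeroPUB W hK htower ht0 hfin hL D hper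
  rw [bsdp_iff_eq_tamagawa_of_rankZero_witness W 3 hmw hfin hL (irreducible_three_of_tower W htower)
    hq hval, hd]
  exact ⟨fun h' => by rw [h'], fun h' => by exact_mod_cast h'⟩

/-- **GRANTED the name, ONE unit Kurihara number at a cyclic level makes `BSD(E,3) ⟺ 3 ∤ ∏_ℓ c_ℓ(E)`**
on a `{tower ∧ t = 0}` analytic-rank-`0` row (a unit forces `∂^{(∞)} = 0`). Memo Cor. C.
[cite: Kim2025RefinedTNC, Thm. 1.2 (rk 0)] [cite: Kim2022StructureSelmer, Thm. 1.9 (1) and (6)]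
[cite: Miller2011LMS, Def. 1.1] -/
theorem bsdp_three_iff_not_dvd_tam_of_kimAtThreeRankZeroPUB_of_kuriharaUnitAt
    (hK : KimAtThreeRankZeroPUB) (hGZK : rank_eq_analyticRank_of_analyticRank_le_one)
    (htower : ∀ n : ℕ, W.HasSurjectiveModNGaloisRep (3 ^ n : ℕ))
    (ht0 : Nat.card {Q : (W.baseChange ℚ_[3]).toAffine.Point // (3 : ℕ) • Q = 0} = 1)
    (hL : W.entireLFunction 1 ≠ 0)
    {N : ℕ} [NeZero N] (D : ModularParametrizationData W N)
    (hper : ∃ u : ℚ, ‖(u : ℚ_[3])‖ = 1 ∧ W.realPeriodRat = u * plusPeriod D.f)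
    (hKu : KuriharaUnitAt W 3 D.f) : BSDp W 3 ↔ ¬ 3 ∣ W.tamagawaProduct := by
  rw [bsdp_three_iff_partialInfty_eq_of_kimAtThreeRankZeroPUB W hK hGZK htower ht0 hL D hper]
  obtain ⟨n, hn0, hn, hcyc, ψ, hψ, hδ⟩ := hKu
  haveI := hn0
  rw [kuriharaPartialInfty_eq_zero_of_ne_zero W 3 D.f ⟨hn, hcyc⟩ ψ hψ hδ]
  haveI : Fact (Nat.Prime 3) := ⟨Nat.prime_three⟩
  constructor
  · intro h hdvd
    have h' : padicValNat 3 W.tamagawaProduct = 0 := by exact_mod_cast h.symm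
    rw [padicValNat.eq_zero_iff] at h'
    rcases h' with h3 | h0 | hnd
    · exact absurd h3 (by norm_num)
    · exact absurd h0 W.tamagawaProduct_pos'.ne'
    · exact hnd hdvd
  · intro h
    rw [padicValNat.eq_zero_of_not_dvd h, Nat.cast_zero]

/-- **LOWER@3 per pair (memo Cor. C): the name + ONE unit Kurihara number + `3 ∤ ∏_ℓ c_ℓ` ⇒
`BSD(E,3)`, BOTH halves, with NO hypothesis on `#Ш_an`** — the `3 ∣ #Ш_an` rows of N11 ∩
`{tower ∧ t = 0}` become closable by one modular-symbol computation each, WITHOUT the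
`Kim2025-preprint` flag (modulo the cell referee's PASS recorded in the name's docstring).
[cite: Kim2025RefinedTNC, Thm. 1.2 (rk 0)] [cite: Miller2011LMS, Def. 1.1] -/
theorem bsdp_three_of_kimAtThreeRankZeroPUB_of_kuriharaUnitAt (hK : KimAtThreeRankZeroPUB)
    (hGZK : rank_eq_analyticRank_of_analyticRank_le_one)
    (htower : ∀ n : ℕ, W.HasSurjectiveModNGaloisRep (3 ^ n : ℕ))
    (ht0 : Nat.card {Q : (W.baseChange ℚ_[3]).toAffine.Point // (3 : ℕ) • Q = 0} = 1)
    (hL : W.entireLFunction 1 ≠ 0)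
    {N : ℕ} [NeZero N] (D : ModularParametrizationData W N)
    (hper : ∃ u : ℚ, ‖(u : ℚ_[3])‖ = 1 ∧ W.realPeriodRat = u * plusPeriod D.f)
    (htam : ¬ 3 ∣ W.tamagawaProduct) (hKu : KuriharaUnitAt W 3 D.f) : BSDp W 3 :=
  (bsdp_three_iff_not_dvd_tam_of_kimAtThreeRankZeroPUB_of_kuriharaUnitAt W hK hGZK htower ht0 hL D
    hper hKu).mpr htam

/-- **The falsifiable prediction**: granted the name, on a `{tower ∧ t = 0}` row with `3 ∣ ∏ c_ℓ`
where `BSD(E,3)` HOLDS there is NO unit cyclic-level Kurihara number (memo 4.4 (d) proves the `c₃`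
part outright: `3 ∣ c₃ ⇒` no unit). [cite: Kim2022StructureSelmer, Conj. 1.10 (PDF p. 8)]
[cite: Miller2011LMS, Def. 1.1] -/
theorem not_kuriharaUnitAt_three_of_kimAtThreeRankZeroPUB_of_bsdp_of_dvd (hK : KimAtThreeRankZeroPUB)
    (hGZK : rank_eq_analyticRank_of_analyticRank_le_one)
    (htower : ∀ n : ℕ, W.HasSurjectiveModNGaloisRep (3 ^ n : ℕ))
    (ht0 : Nat.card {Q : (W.baseChange ℚ_[3]).toAffine.Point // (3 : ℕ) • Q = 0} = 1)
    (hL : W.entireLFunction 1 ≠ 0)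
    {N : ℕ} [NeZero N] (D : ModularParametrizationData W N)
    (hper : ∃ u : ℚ, ‖(u : ℚ_[3])‖ = 1 ∧ W.realPeriodRat = u * plusPeriod D.f)
    (htam : 3 ∣ W.tamagawaProduct) (hB : BSDp W 3) : ¬ KuriharaUnitAt W 3 D.f := fun hKu =>
  (bsdp_three_iff_not_dvd_tam_of_kimAtThreeRankZeroPUB_of_kuriharaUnitAt W hK hGZK htower ht0 hL D
    hper hKu).mp hB htam

/-- **Level-`k` certificates (memo Cor. C on `3 ∣ ∏ c_ℓ` rows): the name + a Kurihara number
`δ̃_n^{(k)} ≠ 0` at a cyclic level `n ∈ 𝒩_k(E,3)` with `k − 1 ≤ ord₃ ∏ c_ℓ` ⇒ `MissingLowerBoundAt W 3`**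
(`ord₃ #Ш_an ≤ ord₃ #Ш`), via the tree's `missingLowerBoundAt_of_kimLower_of_indexCert`; here the
datum carries `3 ∤ c_D` because the tree's LOWER predicate does.
[cite: Kim2022StructureSelmer, Thm. 1.9 (6), §1.5.1] [cite: Miller2011LMS, Def. 1.1] -/
theorem missingLowerBoundAt_three_of_kimAtThreeRankZeroPUB_of_indexCert (hK : KimAtThreeRankZeroPUB)
    (hGZK : rank_eq_analyticRank_of_analyticRank_le_one) (hsurj : Surj W 3)
    (htower : ∀ n : ℕ, W.HasSurjectiveModNGaloisRep (3 ^ n : ℕ))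
    (ht0 : Nat.card {Q : (W.baseChange ℚ_[3]).toAffine.Point // (3 : ℕ) • Q = 0} = 1)
    (hL : W.entireLFunction 1 ≠ 0)
    {N : ℕ} [NeZero N] (D : ModularParametrizationData W N) (hc : ¬ (3 : ℤ) ∣ D.maninConstant)
    (hper : ∃ u : ℚ, ‖(u : ℚ_[3])‖ = 1 ∧ W.realPeriodRat = u * plusPeriod D.f)
    {k n : ℕ} [NeZero n] (hk : 1 ≤ k) (hn : Kato.IsKolyvaginProduct W 3 k n)
    (hcyc : ∀ (ℓ : ℕ) [Fact ℓ.Prime], ℓ ∣ n →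
      Nat.card {P : ((WeierstrassCurve.integralModelInt W).map
          (Int.castRingHom (ZMod ℓ))).toAffine.Point // 3 • P = 0} ≤ 3)
    (ψ : (ℓ : ℕ) → (ZMod ℓ)ˣ →* Multiplicative (ZMod (3 ^ k)))
    (hψ : ∀ ℓ ∈ n.primeFactors, Function.Surjective (ψ ℓ))
    (hδ : kuriharaNumber D.f (3 ^ k) n ψ ≠ 0) (hkt : k - 1 ≤ padicValNat 3 W.tamagawaProduct) :
    MissingLowerBoundAt W 3 :=
  missingLowerBoundAt_of_kimLower_of_indexCert W 3 hGZK
    (kimRankZeroLowerBoundAt_three_of_kimAtThreeRankZeroPUB W hK ht0).2 hsurj htower hL D hc hper hk hn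
    hcyc ψ hψ hδ hkt

/-- **The name implies the X4♯(3) INEQUALITY on its rows**: `#Ш_an = q'` with
`ord₃ #Ш(E/ℚ) ≤ ord₃ q' + ord₃ ∏_ℓ c_ℓ(E)`. [cite: Kim2022StructureSelmer, Thm. 1.9 (6) (PDF p. 8)]
[cite: Miller2011LMS, Def. 1.1] -/
theorem sha_le_three_of_kimAtThreeRankZeroPUB (hK : KimAtThreeRankZeroPUB)
    (hGZK : rank_eq_analyticRank_of_analyticRank_le_one)
    (htower : ∀ n : ℕ, W.HasSurjectiveModNGaloisRep (3 ^ n : ℕ))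
    (ht0 : Nat.card {Q : (W.baseChange ℚ_[3]).toAffine.Point // (3 : ℕ) • Q = 0} = 1)
    (hL : W.entireLFunction 1 ≠ 0)
    {N : ℕ} [NeZero N] (D : ModularParametrizationData W N)
    (hper : ∃ u : ℚ, ‖(u : ℚ_[3])‖ = 1 ∧ W.realPeriodRat = u * plusPeriod D.f) :
    ∃ q' : ℚ, shaAn W = (q' : ℂ) ∧
      (padicValNat 3 W.shaOrder : ℤ) ≤ padicValRat 3 q' + padicValNat 3 W.tamagawaProduct := by
  obtain ⟨hmw, hfin⟩ := hGZK W
    (by rw [analyticRank_eq_zero_of_entireLFunction_one_ne_zero hL]; exact zero_le_one)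
  obtain ⟨q, d, hq, -, hval⟩ :=
    kimShaLengthRankZeroAt_three_of_kimAtThreeRankZeroPUB W hK htower ht0 hfin hL D hper
  exact sha_le_of_rankZero_witness W 3 hmw hfin hL hq hval

/-- **Census shape (N11 window rows): X4 ∧ `r_an = 0` ∧ surj(3) ∧ tower certificate
(`j`-witness ∨ surj(9)) ∧ `t = 0` ∧ datum with period transfer ∧ `3 ∤ ∏ c_ℓ` ∧ ONE unit Kurihara
number ⇒ `BSD(E,3)`** — the name in the binder shape of
`X4RankZero.bsdp_three_of_kimUnitShape_of_cert_of_kuriharaUnitAt` (there CONDITIONAL on the conjecture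
`X4SharpThreeKimUnit`; here on the cell theorem's name and the `t = 0` bit). GZK, modularity.
[cite: SerreAbelianLadic1968, Ch. IV §3.4] [cite: Miller2011LMS, §1 and Def. 1.1] -/
theorem X4RankZero.bsdp_three_of_kimAtThreeRankZeroPUB_of_cert_of_kuriharaUnitAt
    (hK : KimAtThreeRankZeroPUB)
    (hGZK : rank_eq_analyticRank_of_analyticRank_le_one) (hmod : hasEntireLFunction_rat)
    (hr : W.analyticRank = 0) (hsurj : Surj W 3)
    (hcert : (∃ q : ℕ, q.Prime ∧ q ≠ 3 ∧ padicValRat q W.j < 0 ∧ ¬ (3 : ℤ) ∣ padicValRat q W.j) ∨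
      W.HasSurjectiveModNGaloisRep 9)
    (ht0 : Nat.card {Q : (W.baseChange ℚ_[3]).toAffine.Point // (3 : ℕ) • Q = 0} = 1)
    {N : ℕ} [NeZero N] (D : ModularParametrizationData W N)
    (hper : ∃ u : ℚ, ‖(u : ℚ_[3])‖ = 1 ∧ W.realPeriodRat = u * plusPeriod D.f)
    (htam : ¬ 3 ∣ W.tamagawaProduct) (hKu : KuriharaUnitAt W 3 D.f) : BSDp W 3 :=
  bsdp_three_of_kimAtThreeRankZeroPUB_of_kuriharaUnitAt W hK hGZK
    (towerSurj_three_of_surj_of_jWitness_or_nine W hsurj hcert) ht0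
    ((W.analyticRank_eq_zero_iff_holds (hmod W)).mp hr) D hper htam hKu

end Consumers

end Summit.BirchSwinnertonDyer.Rank1Residual.Additive.N11

end
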